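import Mathlib
import Summits.Ventures.HodgeRepro.Tier4.Common.SettingOfData
import Summits.Ventures.HodgeRepro.Tier4.Line4.KTypeTransport
import Summits.Ventures.HodgeRepro.Tier4.Line4.W3OfAdaptedGeneric

/-!
# Tier4/Line4/W3OfMultOne — the wall W3″ of LINE L4 from MULTIPLICITY ONE + the projector shape: the scalar clauses
`ha`/`hb` of `W3OfAdaptedGeneric` DERIVED from `dim ≤ 1` and the stability of the Riesz space (cut C-L4-MULT)

Blind re-derivation cell `pub-hodge-repro`, Tier 4 «prove the step» (README §9–§10), seat t4-L1-p5 (prover, gen 3;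
t4-plan-4 g2's cut C-L4-MULT S13921, taken S13924).  Tree path `lean/Summits/Ventures/HodgeRepro/Tier4/Line4/W3OfMultOne.lean`.
Over a GENERIC plane `W` on typer-2's `Setting.ofAdelicData`; consumes t4-L4-p1 g3's `W3OfAdaptedGeneric` (p685071,
`mixed_two_torus_W3_of_adapted_generic`) and `KTypeTransport` (`rightRegular_const_mul`, `rightRegular_zero`) by name.

WHAT IS PROVED.  `mixed_two_torus_W3_of_multOne`: `mixed_two_torus_W3_of_adapted_generic` with the two scalar clauses
`ha`/`hb` («`R(f̄₁)`, `R(f₂ˇ)` act by one scalar on the conjugate of `Sp K (span U)`») REPLACED by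
* (m) `hmult`: every non-zero irreducible constituent has `finrank ℂ (Sp K (span U)) ≤ 1` — MULTIPLICITY ONE of the
  `(τ′, K)`-type on the constituents (the print-facing fact, per place: the `T′`-weight line of a discrete-series
  constituent, the weight spaces of the compact torus in an irreducible `U(2)`-module, `dim V_f^K = 1` at the newform
  level — displayed, with the cites in the census);
* (s) `hstab₁`/`hstab₂`: the conjugate of `Sp K (span U)` is STABLE under `R(f̄₁)` and `R(f₂ˇ)` — the PROJECTOR SHAPE
  of the test pair (`f₁ = e ⋆ f ⋆ e` for the `(τ′, K)`-idempotent `e`; the analytic half, cut C-L4-PROJ, stays displayed).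
The derivation is linear algebra on a space of dimension `≤ 1` (`exists_scalar_of_finrank_le_one_of_stable`): the zero
space is acted on by any scalar, a line `ℂ v` by the scalar of the image of `v`, carried to every `c • v` by the
ℂ-linearity of `rightRegular` in its function argument; `hvan`, `hadm`, `hJ`, `hfin` are unchanged and the theorem
is `_of_adapted_generic` by name.  Nothing of the wall's content is proved: (m), (s), `hvan`, `hadm`, `hJ` are
displayed hypotheses.
RECORD PRECISION on (m) (t4-crit-2 g4, S13930): `hmult` is quantified over EVERY tree-irreducible `U` (the tree's
`IsIrreducible` asks every invariant subspace of `U` to be `0` or `L²(D_G)`-dense in `U`, with no closedness), while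
the per-place print facts are about CLOSED constituents; a tree-irreducible `U` dense in `V₁ ⊕ … ⊕ V_r` with
`U ∩ V_i = 0` is not excluded by the tree, and for `r ≥ 3` constituents sharing the `(τ′, K)`-type its Riesz space can
be `2`-dimensional — so (m) as quantified here carries, on top of the print facts, the SEPARATION of inequivalent
constituents by test functions (paper only).  The other honest display is (m′) gated by `IsClosedSub U` (t4-L4-p1 g3's
F-L4-DENSE chain, `mixed_two_torus_W3_of_adapted_closed`), to be consumed by a twin of this theorem when it serves.

Nothing here says anything about the status of the Hodge conjecture for CM abelian varieties, which is NOT proved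
(HC_CM is NOT proved by anyone in this repository).
-/

set_option autoImplicit false

noncomputable section

namespace Summit.Ventures.HodgeRepro.Tier4.Line4

open Summit.Ventures.HodgeRepro.Tier4.Common Summit.Ventures.HodgeRepro.Tier4.Line1 MeasureTheory NumberField
open scoped ComplexConjugate

section Scalar

variable {k : Type} [Field k] [NumberField k] (W : PlaneData k) [MeasurableSpace (GA W)] (μ : Measure (GA W))

/-- **an endomorphism of a space of dimension `≤ 1` is a scalar, on the conjugates**: if `V` has `finrank ℂ V ≤ 1`
and `R(f)` maps the conjugates of `V` into the conjugates of `V`, then `R(f)` acts on the conjugates of `V` by one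
scalar (`0` when `V = 0`; the scalar of the image of a generator otherwise, carried to every multiple by the
ℂ-linearity of `R(f)` in its function argument). -/
theorem exists_scalar_of_finrank_le_one_of_stable (V : Submodule ℂ (GA W → ℂ)) (hfin : FiniteDimensional ℂ V)
    (hV : Module.finrank ℂ V ≤ 1) (f : GA W → ℂ)
    (hstab : ∀ ψ ∈ V, ∃ ψ' ∈ V, rightRegular W μ f (fun x => conj (ψ x)) = fun x => conj (ψ' x)) :
    ∃ a : ℂ, ∀ ψ ∈ V, rightRegular W μ f (fun x => conj (ψ x)) = fun x => a * conj (ψ x) := by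
  classical
  haveI := hfin
  obtain ⟨v, hv⟩ := finrank_le_one_iff.mp hV
  -- `R(f)` on the conjugate of the generator
  obtain ⟨v₁, hv₁V, hv₁⟩ := hstab (v : GA W → ℂ) v.2
  obtain ⟨c₁, hc₁⟩ := hv ⟨v₁, hv₁V⟩
  have hc₁' : v₁ = c₁ • (v : GA W → ℂ) := by
    have := congrArg (fun z : V => (z : GA W → ℂ)) hc₁
    simpa using this.symm
  refine ⟨conj c₁, fun ψ hψ => ?_⟩
  obtain ⟨c, hc⟩ := hv ⟨ψ, hψ⟩
  have hc' : ψ = c • (v : GA W → ℂ) := by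
    have := congrArg (fun z : V => (z : GA W → ℂ)) hc
    simpa using this.symm
  have e1 : (fun x => conj (ψ x)) = fun x => conj c * conj ((v : GA W → ℂ) x) := by
    funext x
    rw [hc', Pi.smul_apply, smul_eq_mul, map_mul]
  rw [e1, rightRegular_const_mul, hv₁]
  funext x
  simp only [hc₁', hc', Pi.smul_apply, smul_eq_mul, map_mul]
  ring

end Scalar

section Wall

variable {k : Type} [Field k] [NumberField k] (W : PlaneData k) [MeasurableSpace (GA W)] [BorelSpace (GA W)]
  (R : RTFData W) (μ : Measure (GA W)) [μ.IsHaarMeasure] [R.μT.IsHaarMeasure] [R.μT'.IsHaarMeasure]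
  (DG : Set (GA W)) (fdG : IsFundamentalDomain (rationalPoints W) DG μ) (compG : IsCompact (closure DG))
  (compT : IsCompact (closure R.DT)) (compT' : IsCompact (closure R.DT'))

/-- **W3″-TYPE CONCLUSION FROM MULTIPLICITY ONE AND THE PROJECTOR SHAPE** (cut C-L4-MULT): `mixed_two_torus_W3_of_adapted_generic`
with the scalar clauses `ha`/`hb` replaced by (m) `hmult` — `finrank ℂ (Sp K (span U)) ≤ 1` on every non-zero irreducible
constituent (multiplicity one of the `(τ′, K)`-type) — and (s) `hstab₁`/`hstab₂` — the conjugate of `Sp K (span U)`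
is stable under `R(f̄₁)` and `R(f₂ˇ)` (the projector shape of the test pair); `hfin`, `hvan`, `hadm`, `hJ` as before.
Then some admissible `V₀` carries, on its Riesz space, a Riesz vector of the `T′`-period with a non-zero `T`-period.
(m) ranges over every tree-irreducible `U` — stronger than the per-place print facts by the separation of inequivalent
constituents (S13930); the `IsClosedSub`-gated twin is the other honest display. -/
theorem mixed_two_torus_W3_of_multOne (Sp : Subgroup (GA W) → Submodule ℂ (GA W → ℂ) → Submodule ℂ (GA W → ℂ))
    (hSp_le : ∀ (K : Subgroup (GA W)) (V : Submodule ℂ (GA W → ℂ)), Sp K V ≤ V)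
    (hc : Continuous R.chi) (hu : ∀ a, ‖R.chi a‖ = 1)
    (hc' : Continuous R.chi') (hunit' : ∀ t, ‖R.chi' t‖ = 1)
    (q : QuadData k) (g g' : Matrix (Fin 4) (Fin 4) k) (w₀ : InfinitePlace k)
    (eP eM eP' eM' : InfinitePlace k → ℤ)
    (K : Subgroup (GA W)) (hK : IsCompactOpenIn W (finitePart W) K)
    (hfin : ∀ U : Set (GA W → ℂ), (Setting.ofAdelicData W R μ DG fdG compG compT compT').IsIrrNonzero U →
      FiniteDimensional ℂ (Sp K (Submodule.span ℂ U)))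
    {f₁ f₂ : GA W → ℂ} (h₁ : IsTestFn W f₁) (h₂ : IsTestFn W f₂)
    (hmult : ∀ U : Set (GA W → ℂ), (Setting.ofAdelicData W R μ DG fdG compG compT compT').IsIrrNonzero U →
      Module.finrank ℂ (Sp K (Submodule.span ℂ U)) ≤ 1)
    (hstab₁ : ∀ U : Set (GA W → ℂ), (Setting.ofAdelicData W R μ DG fdG compG compT compT').IsIrrNonzero U →
      ∀ ψ ∈ Sp K (Submodule.span ℂ U), ∃ ψ' ∈ Sp K (Submodule.span ℂ U),
        rightRegular W μ (RTF.cj f₁) (fun x => conj (ψ x)) = fun x => conj (ψ' x))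
    (hstab₂ : ∀ U : Set (GA W → ℂ), (Setting.ofAdelicData W R μ DG fdG compG compT compT').IsIrrNonzero U →
      ∀ ψ ∈ Sp K (Submodule.span ℂ U), ∃ ψ' ∈ Sp K (Submodule.span ℂ U),
        rightRegular W μ (RTF.refl f₂) (fun x => conj (ψ x)) = fun x => conj (ψ' x))
    (hvan : ∀ U : Set (GA W → ℂ), (Setting.ofAdelicData W R μ DG fdG compG compT compT').IsIrrNonzero U →
      ∀ ψ ∈ U, (∀ w ∈ Sp K (Submodule.span ℂ U),
        (Setting.ofAdelicData W R μ DG fdG compG compT compT').inner ψ w = 0) →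
        rightRegular W μ (RTF.cj f₁) (fun x => conj (ψ x)) = fun _ => 0)
    (hadm : ∀ U : Set (GA W → ℂ), (Setting.ofAdelicData W R μ DG fdG compG compT compT').IsIrrNonzero U →
      ∀ a : ℂ, a ≠ 0 →
      (∃ ψ ∈ Sp K (Submodule.span ℂ U), ψ ≠ 0 ∧
        rightRegular W μ (RTF.cj f₁) (fun x => conj (ψ x)) = fun x => a * conj (ψ x)) →
      IsAdmissibleS W (Setting.ofAdelicData W R μ DG fdG compG compT compT') q g g' w₀ eP eM eP' eM'
        (Submodule.span ℂ U))
    (hJ : R.Jc ((Setting.ofAdelicData W R μ DG fdG compG compT compT').conv f₁ f₂) ≠ 0) :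
    ∃ V₀ : Submodule ℂ (GA W → ℂ),
      IsAdmissibleS W (Setting.ofAdelicData W R μ DG fdG compG compT compT') q g g' w₀ eP eM eP' eM' V₀ ∧
      ∃ K₀ : Subgroup (GA W), IsCompactOpenIn W (finitePart W) K₀ ∧
        FiniteDimensional ℂ (Sp K₀ V₀) ∧
        ∃ f : GA W → ℂ, IsRieszVectorOn R μ DG (Sp K₀ V₀) f ∧
          periodLin W R.μT R.DT R.chi (restrictTo W (torusT W) f) ≠ 0 :=
  mixed_two_torus_W3_of_adapted_generic W R μ DG fdG compG compT compT' Sp hSp_le hc hu hc' hunit' q g g' w₀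
    eP eM eP' eM' K hK hfin h₁ h₂
    (fun U hU => exists_scalar_of_finrank_le_one_of_stable W μ _ (hfin U hU) (hmult U hU) (RTF.cj f₁) (hstab₁ U hU))
    (fun U hU => exists_scalar_of_finrank_le_one_of_stable W μ _ (hfin U hU) (hmult U hU) (RTF.refl f₂) (hstab₂ U hU))
    hvan hadm hJ

end Wall

end Summit.Ventures.HodgeRepro.Tier4.Line4

end
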